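import Mathlib

/-!
# `Balaban1983to89.B4Eq242SignedImages` — [Balaban1983RegularityDecay] (2.42) p. 584, THE MULTIPLE REFLECTION METHOD, SIGNED (DIRICHLET) AND FINITE:
# the compression `A|_{X×X}` of a reflection-invariant lattice operator to the interior `X` of a mirror box is inverted EXACTLY by the signed image kernel
# `K(x, y) = Σ_σ sgn(σ)·G(x, σy)` of the inverse `G = A⁻¹` on the covering torus — the engine behind [Balaban1985BackgroundPropagators] p. 394
# «the operator Δ′_a with Dirichlet boundary conditions on ∂Ω₀, i.e. the operator Δ′_a↾Ω₀ = Ω₀Δ′_aΩ₀ … Its inverse is denoted by G′»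

statement-level skeleton of published theorems with citation tags; proofs where landed; nothing here is a claim about the Yang–Mills mass gap

CITATION HEADER (lean-in-tree rule).  [B4] = T. Bałaban, *Regularity and decay of lattice Green's functions*, Commun. Math. Phys. **89** (1983) 571–597
[`Balaban1983RegularityDecay`], p. 584 (journal page = PDF page + 570): «We represent G_j(□) with the help of the propagator G_j with free boundary conditions on
ξZ^d using the multiple reflection method. If □ is written as □ = {x ∈ ξZ^d : 0 ≤ x_μ ≤ M_μ, μ = 1,…,d}, then (2.42) G_j(□; x, x′) = G_j(x, x′) + Σ_{μ=1}^d
G_j(x, (x′_1,…,−x′_μ−ξ,…,x′_d)) + Σ_{μ=1}^d G_j(x, (x′_1,…,2M_μ−ξ−x′_μ,…,x′_d)) + … . Using this representation it is enough to prove (2.35), (2.36) for the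
propagator G_j.» (the UNSIGNED = Neumann form; the SIGNED form below — odd reflections through the mirror hyperplanes, images weighted by `sgn σ = ±1` — is the
Dirichlet counterpart of the same device).  [B9] = T. Bałaban, *Propagators for lattice gauge theories in a background field*, Commun. Math. Phys. **99** (1985)
389–434 [`Balaban1985BackgroundPropagators`], p. 394 [PDF 6] (quoted in the title line; «They depend on the configuration U restricted to Ω₀. This property is
essential for many constructions»); p. 408 l. −14 ff. / p. 409 l. 1–5 (the cube sequence `{Ω_n(□)}` and its letters `G′_□(U)`); [4] = [`Balaban1984PropagatorsII`]
p. 229 [PDF 7]: «Boundary conditions of this type can be interpreted as obtained by building an effective mass on the domain Ω₁∖Ω_k, starting from O(1) on Ω_k up to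
+∞ outside Ω₁.»

WHY THIS FILE (cell `pub-ymgap`, YM Track A D-0062, DAG node N06 = [B9], seat `pub-ymgap-dag-n06-c` g31; ROAD (I) «IMAGES» of LOCATED-31, file D1 of D1–D3).
The N06 certificate's cube tables (`h36b …`, Cor. 3.6 p. 408) are to be read, per the custodian's road of record P4, at PRINT's Dirichlet cube letter
`G′_□(U) = (P_{Ω₀(□)} Δ′_{a,□}(U) P_{Ω₀(□)})⁻¹`; their base ([4] Prop. 2.2 (2.67) at `U = 1`) is in the tree ONLY for the TORUS reading of the cube sequence
(`B6Prop22KLevelTorusCensusL0.prop22_supEntries_kLevelTorus`, r05's `B9Thm31CubeLocalFlat`).  The method of images transports torus bounds to the Dirichlet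
compression when the mirror box is chosen so that every block grid is mirror-symmetric (file D2 `B9CubeSequence408Reflected`): THIS FILE is the model-free linear
algebra of that transport — no lattice, no geometry, no estimate.

WHAT IS PROVED (1 `def` with body — `signedImK` —; theorems; 0 sorry; 0 new named facts; standard axioms).  For a finite index type `Y`, a commutative ring `R`,
matrices `A G : Matrix Y Y R`:
* §1 `signedImK Γ σ s G x y := Σ_{i ∈ Γ} s i · G x (σ i y)` (the signed image kernel of `G` for a finite INDEXED family `σ : ι → Perm Y`, `Γ : Finset ι`, signs `s : ι → R`) and its
  bookkeeping (`signedImK_apply`); ★ `submatrix_perm_eq_of_mul_eq_one` — if `A·G = 1` and `A` is `τ`-invariant (`A (τu) (τw) = A u w`) then so is `G` (uniqueness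
  of the two-sided inverse on a finite type, `Matrix.mul_eq_one_comm`).
* §2 ★ `sum_sign_mul_apply_perm_eq_zero` — the MIRROR CANCELLATION: if `z` is fixed by a symmetry `τ ≠ 1` under which `G` is invariant and an index involution `m`
  of `Γ` realises left multiplication by `τ` with a sign flip (`σ_{m i} = τσ_i`, `s_{m i} = −s_i`), then `Σ_{i ∈ Γ} s_i · G z (σ_i y) = 0` (`Finset.sum_involution`).
* §3 ★★★ `compress_mul_signedImK` / `signedImK_mul_compress` / `inv_compress_eq_signedImK` / `isUnit_compress` — under (a) `A·G = 1`; (b) a distinguished index `e ∈ Γ`, `σ_e = 1`,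
  `s_e = 1`; (c) FREENESS `σ_i y ∉ X` for `i ∈ Γ ∖ {e}`, `y ∈ X`; (d) MIRRORS: every `z ∉ X` with `A x z ≠ 0` for some `x ∈ X` is fixed by some `τ_t`, `t ∈ T`, where
  each `τ_t ≠ 1` leaves `A` invariant and comes with an index involution `m_t` of `Γ` (`σ_{m_t i} = τ_tσ_i`, `s_{m_t i} = −s_i`): the compression `A|_{X×X}` (`Matrix.submatrix` along `X ↪ Y`) times the compressed
  signed image kernel `K|_{X×X}` is `1`, on BOTH sides, hence `(A|_{X×X})⁻¹ = K|_{X×X}` and `A|_{X×X}` is a unit — print's «Using this representation it is enough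
  to prove (2.35), (2.36) for the propagator G_j», Dirichlet form.
* §4 ★ `abs_signedImK_le` / `abs_signedImK_le_of_antitone` (over `ℝ`) — the DECAY FOLD: `|K x y| ≤ #Γ · g x y` whenever `|s_i| ≤ 1`, `|G u w| ≤ g u w` and the
  majorant does not increase towards images (`g x (σ_i y) ≤ g x y`), resp. for `g u w = c u · φ (dist u w)` with `φ` antitone and `dist x y ≤ dist x (σ_i y)`.

PROOF.  Ours (linear algebra).  §3: `Σ_{z∈X} A x z K z y = Σ_i s_i (Σ_{z∈Y} − Σ_{z∉X}) A x z G z (σ_iy) = Σ_i s_i [x = σ_iy] − Σ_{z∉X} A x z (Σ_i s_i G z (σ_iy))`; the first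
sum is `[x = y]` by (b)–(c), the second vanishes termwise by (d) and §2.

HONEST SCOPE / NOT CLAIMED.  An abstract engine: no lattice, no reflection group is constructed here (file D2 supplies `ι = Fin (d+1) → Bool`, `σ_ε` = the face
reflections of the doubled torus, `s_ε = (−1)^{#ε}`, `T` = the mirrored directions with `m_μ ε = ε ⊻ δ_μ`, `X` = the open mirror box, and checks (c)–(d) for r05's reflected cube family); no bound of [B4]/[4]/[B9] is proved
or asserted; the unsigned (Neumann, infinite-source) engine of `B4Reflection242` §1 is neither used nor modified.  Count-neutral; N06 NOT discharged; nothing on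
`d = 4`, the continuum, reflection positivity, the mass gap or Clay.  No `sorry`, no `axiom`, no `instance`, no `notation`.  Seat `pub-ymgap-dag-n06-c` g31,
2026-08-31; `--supports stmt-QuantumFields-27239`.

RELATED IN THE TREE, NOT DUPLICATED (searched 2026-08-31: `rg -l 'signedImK|SignedImages|method of images|odd reflection'` over `lean/Literature` + `lean/Summits`;
`lean search 'signedImK|compress_mul_signedImK'` = ∅): `B4Reflection242` (§1 `ImageSystem.foldOp_mul_imK`: UNSIGNED images of an infinite-lattice source folded to a
Neumann box — other sector, other source), `B7Eq141TorusImagesCount` (period images, a counting lemma), n05-c's `B8Eq191FlatDirichlet*` (Agmon road to Dirichlet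
decay — other method).
-/

namespace Literature.MathematicalPhysics.QuantumFieldTheory.Balaban1983to89.B4Eq242SignedImages

open Finset Matrix

variable {Y : Type*} {R : Type*} {ι : Type*}

/-! ## §1  The signed image kernel; invariance of the inverse -/

section Kernel

variable [CommRing R]

/-- **THE SIGNED IMAGE KERNEL** `K(x, y) = Σ_{i ∈ Γ} s_i·G(x, σ_i y)` of a kernel `G` for a finite INDEXED family `σ : ι → Perm Y` of lattice symmetries with
signs `s : ι → R` ((2.42) with signs: the Dirichlet form of the multiple reflection method; the index type carries the bookkeeping of the reflection group,
e.g. `ι = Fin (d+1) → Bool`, `s ε = (−1)^{#ε}`). [cite: Balaban1983RegularityDecay, (2.42) p.584; Balaban1985BackgroundPropagators, p.394 (Dirichlet boundary conditions on ∂Ω₀)] -/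
def signedImK (Γ : Finset ι) (σ : ι → Equiv.Perm Y) (s : ι → R) (G : Matrix Y Y R) : Matrix Y Y R :=
  fun x y => ∑ i ∈ Γ, s i * G x (σ i y)

/-- the entries of the signed image kernel. [cite: Balaban1983RegularityDecay, (2.42) p.584, dictionary] -/
theorem signedImK_apply (Γ : Finset ι) (σ : ι → Equiv.Perm Y) (s : ι → R) (G : Matrix Y Y R) (x y : Y) :
    signedImK Γ σ s G x y = ∑ i ∈ Γ, s i * G x (σ i y) := rfl

end Kernel

/-- a matrix invariant under a permutation `τ` of the indices is its own `τ`-submatrix. [cite: Balaban1983RegularityDecay, (2.42) p.584, bookkeeping] -/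
theorem submatrix_perm_eq_of_invariant {A : Matrix Y Y R} {τ : Equiv.Perm Y} (hA : ∀ u w, A (τ u) (τ w) = A u w) :
    A.submatrix τ τ = A := by
  ext u w
  exact hA u w

section Inverse

variable [Fintype Y] [DecidableEq Y] [CommRing R]

/-- ★ **THE INVERSE INHERITS THE SYMMETRY**: if `A·G = 1` on a finite index type and `A` is invariant under the permutation `τ`, then `G` is invariant under `τ`
(the `τ`-conjugate of `G` is another two-sided inverse). [cite: Balaban1983RegularityDecay, (2.42) p.584 («the propagator G_j with free boundary conditions»: symmetric source), bookkeeping] -/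
theorem submatrix_perm_eq_of_mul_eq_one {A G : Matrix Y Y R} (hAG : A * G = 1) {τ : Equiv.Perm Y} (hA : ∀ u w, A (τ u) (τ w) = A u w) :
    ∀ u w, G (τ u) (τ w) = G u w := by
  -- `A·(G∘τ) = (A∘τ)·(G∘τ) = (A·G)∘τ = 1`
  have h1 : A * G.submatrix τ τ = 1 := by
    conv_lhs => rw [← submatrix_perm_eq_of_invariant hA]
    rw [Matrix.submatrix_mul_equiv A G τ τ τ, hAG, Matrix.submatrix_one_equiv]
  -- uniqueness of the inverse: `G∘τ = (G·A)·(G∘τ) = G·(A·(G∘τ)) = G`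
  have hGA : G * A = 1 := mul_eq_one_comm.1 hAG
  have h2 : G.submatrix τ τ = G := by
    calc G.submatrix τ τ = G * A * G.submatrix τ τ := by rw [hGA, Matrix.one_mul]
      _ = G := by rw [Matrix.mul_assoc, h1, Matrix.mul_one]
  intro u w
  have := congrFun (congrFun h2 u) w
  simpa [Matrix.submatrix_apply] using this

end Inverse

/-! ## §2  The mirror cancellation -/

section Mirror

variable [CommRing R]

/-- ★ **MIRROR CANCELLATION**: at a site `z` fixed by a symmetry `τ ≠ 1` under which `G` is invariant, and for an indexed family stable under an index map `m`
with `σ_{m i} = τ·σ_i`, `s_{m i} = −s_i`, `m (m i) = i` (the images pair off through the mirror), the signed image column vanishes: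
`Σ_{i∈Γ} s_i · G z (σ_i y) = 0` — the mechanism that puts the ZERO boundary value on the mirror hyperplanes.
[cite: Balaban1983RegularityDecay, (2.42) p.584; Balaban1985BackgroundPropagators, p.394 (Dirichlet boundary conditions)] -/
theorem sum_sign_mul_apply_perm_eq_zero (Γ : Finset ι) (σ : ι → Equiv.Perm Y) (s : ι → R) (G : Matrix Y Y R)
    {τ : Equiv.Perm Y} (hτ1 : τ ≠ 1) (hG : ∀ u w, G (τ u) (τ w) = G u w) (m : ι → ι)
    (hm : ∀ i ∈ Γ, m i ∈ Γ ∧ σ (m i) = τ * σ i ∧ s (m i) = -s i ∧ m (m i) = i) {z : Y} (hz : τ z = z) (y : Y) :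
    ∑ i ∈ Γ, s i * G z (σ i y) = 0 := by
  refine Finset.sum_involution (fun i _ => m i) ?_ ?_ ?_ ?_
  · -- `f i + f (m i) = 0`
    intro i hi
    obtain ⟨-, hσ, hs, -⟩ := hm i hi
    have hGz : G z (σ (m i) y) = G z (σ i y) := by
      rw [hσ, Equiv.Perm.mul_apply]
      conv_lhs => rw [← hz]
      exact hG z (σ i y)
    rw [hs, hGz, neg_mul, add_neg_cancel]
  · -- no fixed index: `m i = i` would force `τ = 1`
    intro i hi _ h
    apply hτ1
    obtain ⟨-, hσ, -, -⟩ := hm i hi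
    rw [h] at hσ
    have := congrArg (· * (σ i)⁻¹) hσ
    simpa using this.symm
  · exact fun i hi => (hm i hi).1
  · exact fun i hi => (hm i hi).2.2.2

end Mirror

/-! ## §3  The compression of `A` to the interior `X` is inverted by the compressed signed image kernel -/

section Compression

variable [Fintype Y] [DecidableEq Y] [CommRing R] (X : Finset Y)

omit [Fintype Y] [DecidableEq Y] [CommRing R] in
/-- the compression `A|_{X×X}` of a matrix to a finite set of indices («Ω₀Δ′_aΩ₀» read as an operator on functions on `Ω₀`).
[cite: Balaban1985BackgroundPropagators, p.394 («Δ′_a↾Ω₀ = Ω₀Δ′_aΩ₀»), dictionary] -/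
theorem submatrix_val_apply (A : Matrix Y Y R) (x y : ↥X) :
    A.submatrix (fun v : ↥X => (v : Y)) (fun v : ↥X => (v : Y)) x y = A x y := rfl

variable {κ : Type*}

/-- ★★★ **THE SIGNED MULTIPLE REFLECTION METHOD — the compression times the compressed signed image kernel is the identity.**
Hypotheses: (a) `A·G = 1` on the covering index type; (b) a distinguished index `e ∈ Γ` with `σ_e = 1`, `s_e = 1`; (c) freeness — a non-trivially indexed image of
an interior site is never interior; (d) mirrors — every exterior site coupled to the interior by `A` is fixed by a mirror symmetry `τ_t`, `t ∈ T`, where each `τ_t ≠ 1`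
leaves `A` invariant and comes with an index involution `m_t` of `Γ` realising left multiplication by `τ_t` with a sign flip.  Conclusion:
`Σ_{z∈X} A x z · K z y = [x = y]` for `x, y ∈ X`, `K = signedImK Γ σ s G`.
[cite: Balaban1983RegularityDecay, (2.42) p.584 («Using this representation it is enough to prove (2.35), (2.36) for the propagator G_j»); Balaban1985BackgroundPropagators, p.394] -/
theorem compress_mul_signedImK {A G : Matrix Y Y R} (hAG : A * G = 1)
    (Γ : Finset ι) (σ : ι → Equiv.Perm Y) (s : ι → R) {e : ι} (he : e ∈ Γ) (hσe : σ e = 1) (hse : s e = 1)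
    (hfree : ∀ i ∈ Γ, i ≠ e → ∀ y ∈ X, σ i y ∉ X)
    (T : Finset κ) (τ : κ → Equiv.Perm Y) (m : κ → ι → ι)
    (hT : ∀ t ∈ T, τ t ≠ 1 ∧ (∀ u w, A (τ t u) (τ t w) = A u w) ∧
      ∀ i ∈ Γ, m t i ∈ Γ ∧ σ (m t i) = τ t * σ i ∧ s (m t i) = -s i ∧ m t (m t i) = i)
    (hmir : ∀ x ∈ X, ∀ z, z ∉ X → A x z ≠ 0 → ∃ t ∈ T, τ t z = z) :
    A.submatrix (fun v : ↥X => (v : Y)) (fun v : ↥X => (v : Y)) *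
        (signedImK Γ σ s G).submatrix (fun v : ↥X => (v : Y)) (fun v : ↥X => (v : Y)) = 1 := by
  ext x y
  rw [Matrix.mul_apply, Matrix.one_apply]
  simp only [Matrix.submatrix_apply, signedImK_apply]
  -- the full row of `A·G` at `(x, σ_i y)`
  have hrow : ∀ i : ι, ∑ z : Y, A x z * G z (σ i y) = if (x : Y) = σ i y then 1 else 0 := by
    intro i
    have := congrFun (congrFun hAG x) (σ i y)
    rw [Matrix.mul_apply, Matrix.one_apply] at this
    exact this
  -- split `Σ_{z ∈ Y}` into the interior and the exterior
  have hsplit : ∀ i : ι,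
      ∑ z : ↥X, A x z * G z (σ i y) = (if (x : Y) = σ i y then 1 else 0) - ∑ z ∈ Xᶜ, A x z * G z (σ i y) := by
    intro i
    rw [← hrow i, ← Finset.sum_add_sum_compl X (fun z => A x z * G z (σ i y)), Finset.sum_coe_sort X (fun z => A x z * G z (σ i y))]
    ring
  -- exchange the sums
  have hlhs : ∑ z : ↥X, A x z * ∑ i ∈ Γ, s i * G z (σ i y) = ∑ i ∈ Γ, s i * ∑ z : ↥X, A x z * G z (σ i y) := by
    simp_rw [Finset.mul_sum]
    rw [Finset.sum_comm]
    refine Finset.sum_congr rfl fun i _ => Finset.sum_congr rfl fun z _ => ?_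
    ring
  rw [hlhs]
  simp_rw [hsplit, mul_sub, Finset.sum_sub_distrib]
  -- the exterior part vanishes
  have hext : ∑ i ∈ Γ, s i * ∑ z ∈ Xᶜ, A x z * G z (σ i y) = 0 := by
    have hx : ∑ i ∈ Γ, s i * ∑ z ∈ Xᶜ, A x z * G z (σ i y) = ∑ z ∈ Xᶜ, A x z * ∑ i ∈ Γ, s i * G z (σ i y) := by
      simp_rw [Finset.mul_sum]
      rw [Finset.sum_comm]
      refine Finset.sum_congr rfl fun z _ => Finset.sum_congr rfl fun i _ => ?_
      ring
    rw [hx]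
    refine Finset.sum_eq_zero fun z hz => ?_
    rw [Finset.mem_compl] at hz
    by_cases hAxz : A x z = 0
    · rw [hAxz, zero_mul]
    · obtain ⟨t, htT, htz⟩ := hmir x x.2 z hz hAxz
      obtain ⟨hτ1, hτA, hmt⟩ := hT t htT
      rw [sum_sign_mul_apply_perm_eq_zero Γ σ s G hτ1 (submatrix_perm_eq_of_mul_eq_one hAG hτA) (m t) hmt htz y, mul_zero]
  rw [hext, sub_zero]
  -- the interior part: only the distinguished index sees `x = σ_i y`
  classical
  rw [← Finset.add_sum_erase Γ _ he]
  have hrest : ∑ i ∈ Γ.erase e, s i * (if (x : Y) = σ i y then (1 : R) else 0) = 0 := by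
    refine Finset.sum_eq_zero fun i hi => ?_
    rw [Finset.mem_erase] at hi
    have hne : (x : Y) ≠ σ i y := fun h => hfree i hi.2 hi.1 y y.2 (h ▸ x.2)
    rw [if_neg hne, mul_zero]
  rw [hrest, add_zero, hse, one_mul, hσe, Equiv.Perm.one_apply]
  by_cases hxy : x = y
  · subst hxy; simp
  · have : (x : Y) ≠ (y : Y) := fun h => hxy (Subtype.ext h)
    simp [hxy, this]

/-- ★★★ the same identity ON THE OTHER SIDE: `K|_{X×X} · A|_{X×X} = 1` (a one-sided inverse of a square matrix over a commutative ring is two-sided).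
[cite: Balaban1983RegularityDecay, (2.42) p.584; Balaban1985BackgroundPropagators, p.394] -/
theorem signedImK_mul_compress {A G : Matrix Y Y R} (hAG : A * G = 1)
    (Γ : Finset ι) (σ : ι → Equiv.Perm Y) (s : ι → R) {e : ι} (he : e ∈ Γ) (hσe : σ e = 1) (hse : s e = 1)
    (hfree : ∀ i ∈ Γ, i ≠ e → ∀ y ∈ X, σ i y ∉ X)
    (T : Finset κ) (τ : κ → Equiv.Perm Y) (m : κ → ι → ι)
    (hT : ∀ t ∈ T, τ t ≠ 1 ∧ (∀ u w, A (τ t u) (τ t w) = A u w) ∧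
      ∀ i ∈ Γ, m t i ∈ Γ ∧ σ (m t i) = τ t * σ i ∧ s (m t i) = -s i ∧ m t (m t i) = i)
    (hmir : ∀ x ∈ X, ∀ z, z ∉ X → A x z ≠ 0 → ∃ t ∈ T, τ t z = z) :
    (signedImK Γ σ s G).submatrix (fun v : ↥X => (v : Y)) (fun v : ↥X => (v : Y)) *
        A.submatrix (fun v : ↥X => (v : Y)) (fun v : ↥X => (v : Y)) = 1 :=
  mul_eq_one_comm.1 (compress_mul_signedImK X hAG Γ σ s he hσe hse hfree T τ m hT hmir)

/-- ★★★ **THE DIRICHLET GREEN's FUNCTION IS THE COMPRESSED SIGNED IMAGE KERNEL**: `(A|_{X×X})⁻¹ = K|_{X×X}`.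
[cite: Balaban1983RegularityDecay, (2.42) p.584; Balaban1985BackgroundPropagators, p.394 («Its inverse is denoted by G′»)] -/
theorem inv_compress_eq_signedImK {A G : Matrix Y Y R} (hAG : A * G = 1)
    (Γ : Finset ι) (σ : ι → Equiv.Perm Y) (s : ι → R) {e : ι} (he : e ∈ Γ) (hσe : σ e = 1) (hse : s e = 1)
    (hfree : ∀ i ∈ Γ, i ≠ e → ∀ y ∈ X, σ i y ∉ X)
    (T : Finset κ) (τ : κ → Equiv.Perm Y) (m : κ → ι → ι)
    (hT : ∀ t ∈ T, τ t ≠ 1 ∧ (∀ u w, A (τ t u) (τ t w) = A u w) ∧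
      ∀ i ∈ Γ, m t i ∈ Γ ∧ σ (m t i) = τ t * σ i ∧ s (m t i) = -s i ∧ m t (m t i) = i)
    (hmir : ∀ x ∈ X, ∀ z, z ∉ X → A x z ≠ 0 → ∃ t ∈ T, τ t z = z) :
    (A.submatrix (fun v : ↥X => (v : Y)) (fun v : ↥X => (v : Y)))⁻¹ =
      (signedImK Γ σ s G).submatrix (fun v : ↥X => (v : Y)) (fun v : ↥X => (v : Y)) :=
  Matrix.inv_eq_right_inv (compress_mul_signedImK X hAG Γ σ s he hσe hse hfree T τ m hT hmir)

/-- ★ the compression is invertible («G′ = (Δ′_a↾Ω₀)⁻¹ exists»). [cite: Balaban1985BackgroundPropagators, p.394; Balaban1983RegularityDecay, (2.42) p.584] -/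
theorem isUnit_compress {A G : Matrix Y Y R} (hAG : A * G = 1)
    (Γ : Finset ι) (σ : ι → Equiv.Perm Y) (s : ι → R) {e : ι} (he : e ∈ Γ) (hσe : σ e = 1) (hse : s e = 1)
    (hfree : ∀ i ∈ Γ, i ≠ e → ∀ y ∈ X, σ i y ∉ X)
    (T : Finset κ) (τ : κ → Equiv.Perm Y) (m : κ → ι → ι)
    (hT : ∀ t ∈ T, τ t ≠ 1 ∧ (∀ u w, A (τ t u) (τ t w) = A u w) ∧
      ∀ i ∈ Γ, m t i ∈ Γ ∧ σ (m t i) = τ t * σ i ∧ s (m t i) = -s i ∧ m t (m t i) = i)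
    (hmir : ∀ x ∈ X, ∀ z, z ∉ X → A x z ≠ 0 → ∃ t ∈ T, τ t z = z) :
    IsUnit (A.submatrix (fun v : ↥X => (v : Y)) (fun v : ↥X => (v : Y))) :=
  ⟨⟨_, _, compress_mul_signedImK X hAG Γ σ s he hσe hse hfree T τ m hT hmir,
    signedImK_mul_compress X hAG Γ σ s he hσe hse hfree T τ m hT hmir⟩, rfl⟩

/-- ★ **THE DIRICHLET SOLUTION FORMULA**: for `x ∈ X` and any `f` on `X`, the unique solution `φ = (A|_{X×X})⁻¹ f` of `A|_{X×X} φ = f` reads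
`φ(x) = Σ_{y∈X} Σ_{i∈Γ} s_i · G(x, σ_i y) f(y)`. [cite: Balaban1985BackgroundPropagators, p.394 (the Dirichlet inverse G′); Balaban1983RegularityDecay, (2.42) p.584] -/
theorem inv_compress_mulVec {A G : Matrix Y Y R} (hAG : A * G = 1)
    (Γ : Finset ι) (σ : ι → Equiv.Perm Y) (s : ι → R) {e : ι} (he : e ∈ Γ) (hσe : σ e = 1) (hse : s e = 1)
    (hfree : ∀ i ∈ Γ, i ≠ e → ∀ y ∈ X, σ i y ∉ X)
    (T : Finset κ) (τ : κ → Equiv.Perm Y) (m : κ → ι → ι)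
    (hT : ∀ t ∈ T, τ t ≠ 1 ∧ (∀ u w, A (τ t u) (τ t w) = A u w) ∧
      ∀ i ∈ Γ, m t i ∈ Γ ∧ σ (m t i) = τ t * σ i ∧ s (m t i) = -s i ∧ m t (m t i) = i)
    (hmir : ∀ x ∈ X, ∀ z, z ∉ X → A x z ≠ 0 → ∃ t ∈ T, τ t z = z) (f : ↥X → R) (x : ↥X) :
    ((A.submatrix (fun v : ↥X => (v : Y)) (fun v : ↥X => (v : Y)))⁻¹ *ᵥ f) x = ∑ y : ↥X, (∑ i ∈ Γ, s i * G x (σ i y)) * f y := by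
  rw [inv_compress_eq_signedImK X hAG Γ σ s he hσe hse hfree T τ m hT hmir, Matrix.mulVec]
  rfl

end Compression

/-! ## §4  The decay fold: bounds of the source kernel pass to the signed image kernel -/

section Decay

/-- ★ **THE DECAY FOLD**: if `|s_i| ≤ 1`, `|G u w| ≤ g u w`, and the majorant does not increase when the second argument is moved to one of its images
(`g x (σ_i y) ≤ g x y` for `i ∈ Γ`), then `|K x y| ≤ #Γ · g x y` — «it is enough to prove (2.35), (2.36) for the propagator G_j».
[cite: Balaban1983RegularityDecay, (2.42) p.584] -/
theorem abs_signedImK_le (Γ : Finset ι) (σ : ι → Equiv.Perm Y) (s : ι → ℝ) (G : Matrix Y Y ℝ)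
    (hs : ∀ i ∈ Γ, |s i| ≤ 1) (g : Y → Y → ℝ) (hG : ∀ u w, |G u w| ≤ g u w) (x y : Y)
    (hmono : ∀ i ∈ Γ, g x (σ i y) ≤ g x y) :
    |signedImK Γ σ s G x y| ≤ Γ.card * g x y := by
  rw [signedImK_apply]
  calc |∑ i ∈ Γ, s i * G x (σ i y)| ≤ ∑ i ∈ Γ, |s i * G x (σ i y)| := Finset.abs_sum_le_sum_abs _ _
    _ ≤ ∑ i ∈ Γ, g x y := by
        refine Finset.sum_le_sum fun i hi => ?_
        rw [abs_mul]
        have hg0 : 0 ≤ g x (σ i y) := le_trans (abs_nonneg _) (hG x (σ i y))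
        calc |s i| * |G x (σ i y)| ≤ 1 * g x (σ i y) := mul_le_mul (hs i hi) (hG x (σ i y)) (abs_nonneg _) zero_le_one
          _ = g x (σ i y) := one_mul _
          _ ≤ g x y := hmono i hi
    _ = Γ.card * g x y := by rw [Finset.sum_const, nsmul_eq_mul]

/-- ★ the decay fold for an ANTITONE PROFILE of a distance that images do not shorten: if `|G u w| ≤ c u · φ (dist u w)` with `φ` antitone, `0 ≤ c x`, and
`dist x y ≤ dist x (σ_i y)` for `i ∈ Γ`, then `|K x y| ≤ #Γ · c x · φ (dist x y)` (the shape of [4] (2.67) / [B9] (3.42): `φ t = e^{−δ₀ t}`).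
[cite: Balaban1983RegularityDecay, (2.42) p.584, (2.35) p.582; Balaban1985BackgroundPropagators, Thm 3.1 (3.42) p.397] -/
theorem abs_signedImK_le_of_antitone (Γ : Finset ι) (σ : ι → Equiv.Perm Y) (s : ι → ℝ) (G : Matrix Y Y ℝ)
    (hs : ∀ i ∈ Γ, |s i| ≤ 1) {D : Type*} [Preorder D] (dist : Y → Y → D) (c : Y → ℝ) (φ : D → ℝ) (hφ : Antitone φ)
    (hG : ∀ u w, |G u w| ≤ c u * φ (dist u w)) (x y : Y) (hc : 0 ≤ c x)
    (hdist : ∀ i ∈ Γ, dist x y ≤ dist x (σ i y)) :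
    |signedImK Γ σ s G x y| ≤ Γ.card * (c x * φ (dist x y)) :=
  abs_signedImK_le Γ σ s G hs (fun u w => c u * φ (dist u w)) hG x y
    (fun i hi => mul_le_mul_of_nonneg_left (hφ (hdist i hi)) hc)

end Decay

end Literature.MathematicalPhysics.QuantumFieldTheory.Balaban1983to89.B4Eq242SignedImages
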